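import Summits.ABC.IUTFork.Cor312LicenceShallowRealLevels
import Literature.IUT.LogVolume.TensorPacketShellHull
import Literature.IUT.LogVolume.LogUnitsSubmodule
import HarnessLib

/-!
# D-0079 RESCUE sub-cell R-H — a LEVEL MOVER from a NON-LOG-UNIT CERTIFICATE at any finite place
# (the one-place engine behind the hull-reach family of ROUND 1: rows 15 «slotreach», 17 «levelreach», 18, 20)

PROOF-ONLY file (D-0012: 0 definitions, 0 `Prop` facts; abc-iut cell, rung LADDER-ABC:A2.RP → A2.RESCUE-H; seat abc-iut-rp-d3 gen 5 =
R-H ROUND 1 «k2 DESK hand» for row 15 of `plan/rescue/R-H/RH-CANDIDATES.tsv`, abc-iut-rh-lead D-0107; the hand proof is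
abc-iut-lens-wuc-2's `staging/RH/abc-iut-lens-wuc-2/CANDIDATE.md` §B (1)–(3), the level-certificate vocabulary abc-iut-lens-nearmiss-2's).
TAKES NO SIDE on [IUTchIII] Cor. 3.12 or on any author; OUR typed objects (Dupuy–Hilado's (Ind2) = ALL `ℤ_p`-lattice automorphisms of the
log-shell, STRONGER-THAN-PRINT); typed ≠ proved; instantiated ≠ endorsed. Inputs consumed BY NAME: abc-iut-w5-d180's transitivity
`Thm311.Real.exists_mem_ismDH_apply_eq_of_primitive` (Weil BNT II §2 Th. 1), campaign-S's `Literature.IUT.LogVolume.closedBall_subset_logUnits`,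
`exists_norm_isMaxOn_logUnits`, `norm_pos_of_isMaxOn_logUnits`, `natCast_mul_mem_logUnits` ([IUTchIV] Prop. 1.2 (i): `log_p(𝒪^×)` is a
compact open `ℤ_p`-lattice containing `{‖z‖ ≤ p⁻²}`).

THE LEMMA (`exists_mover_of_not_mem_logUnits`; fibre form `…_fibre`). Let `Λ = log_p(𝒪_v^×) ⊂ K_v` (any `p`, any ramification). If
`p^{C−1}·s = u ∉ Λ`, then `s` lies on an EXACT level `k ≥ C` of `Λ` — the set of `k` with `p^k s ∈ Λ` is up-closed (`p·Λ ⊆ Λ`), non-empty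
(`Λ ⊇ {‖z‖ ≤ p⁻²}` and `‖p^k s‖ → 0`) and misses `C − 1`; a vector `z₀` of LARGEST norm in `Λ` (compactness) is PRIMITIVE (`z₀ ∉ p·Λ`:
else `z₀/p ∈ Λ` is longer); so (Ind2), transitive on the primitive vectors of `p^{−k}·Λ`, carries `s` to `p^{−k}·z₀`, of norm
`p^k·‖z₀‖ ≥ p^C·‖z‖` for EVERY `z ∈ Λ`. No evaluation of `Λ` is needed; `C` may be any integer. This is what turns an R-H candidate's
numeric dictionary (a non-log-unit `u_x` of valuation `≥ n₀(x) − 1` = a certificate FROM BELOW of the inner conductor, and one log-unit of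
norm `≥ p^{λ_x}`) into movers. [cite: WeilBNT1967, Ch. II §2, Th. 1] [cite: DupuyHilado2025, §4.9] [cite: Mochizuki2012, IUTchIV Prop. 1.2 (i) p. 10]
-/

noncomputable section

open Set Function
open scoped Pointwise

namespace Summit.ABC.IUTFork.Repair.RHLevelMover

open Thm311 Thm311.Real Cor312 Cor312.Setting Cor312Vol Literature.IUT.LogThetaLattice Literature.IUT.LogVolume
open Literature.NumberTheory.NumberFields NumberField IsDedekindDomain Metric

/-- Integer bookkeeping for the box constraints `‖y‖ ≤ 1`: `e·⌈N/e⌉ ≤ N + e − 1`, with the ceiling written as Lean's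
`-((-N) / e)` (Euclidean = floor division by `e > 0`). [folklore] -/
theorem mul_neg_ediv_neg_le (e : ℕ) (he : 1 ≤ e) (N : ℤ) : (e : ℤ) * (-((-N) / (e : ℤ))) ≤ N + e - 1 := by
  have he0 : (0 : ℤ) < e := by exact_mod_cast he
  have h1 := Int.emod_nonneg (-N) he0.ne'
  have h2 := Int.emod_lt_of_pos (-N) he0
  have h3 := Int.emod_def (-N) (e : ℤ)
  linarith

section OnePlace

variable {F : Type} [Field F] [NumberField F] {p : ℕ} [hp : Fact p.Prime]
  {logv : PadicLogs F} (hlog : LogvAnalyticAt p logv)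
  (v : HeightOneSpectrum (𝓞 F)) (hv : ((p : ℕ) : 𝓞 F) ∈ v.asIdeal)

/-- The norm of a `p`-power homothety on the rescaled completion: `‖p^k • x‖ = p^{−k}·‖x‖`. [folklore] -/
theorem norm_zpow_prime_smul (k : ℤ) (x : RescaledCompletion F p v hv) :
    ‖((p : ℚ_[p]) ^ k) • x‖ = (p : ℝ) ^ (-k) * ‖x‖ := by
  rw [norm_smul, norm_zpow, Padic.norm_p, inv_zpow']

include hlog in
/-- **A LEVEL MOVER FROM A NON-LOG-UNIT CERTIFICATE, at any finite place** (any `p`, any ramification). Let `Λ = log_p(𝒪_v^×)`.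
If `p^{C−1}·s = u ∉ Λ`, then `s` lies on an exact level `k ≥ C` of `Λ` (`p·Λ ⊆ Λ`, `{‖z‖ ≤ p⁻²} ⊆ Λ`), a largest-norm vector
`z₀ ∈ Λ` is primitive, and Dupuy–Hilado's (Ind2) — transitive on the primitive vectors of `p^{−k}·Λ` — carries `s` to `p^{−k}·z₀`,
of norm `p^k·‖z₀‖ ≥ p^C·‖z‖` for every `z ∈ Λ`. [cite: WeilBNT1967, Ch. II §2, Th. 1] [cite: DupuyHilado2025, §4.9]
[cite: Mochizuki2012, IUTchIV Prop. 1.2 (i) p. 10] -/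
theorem exists_mover_of_not_mem_logUnits {s u z : RescaledCompletion F p v hv} {C : ℤ}
    (hsu : ((p : ℚ_[p]) ^ (C - 1)) • s = u)
    (hu : u ∉ (logUnits (RescaledCompletion F p v hv) : Set (RescaledCompletion F p v hv)))
    (hz : z ∈ (logUnits (RescaledCompletion F p v hv) : Set (RescaledCompletion F p v hv))) :
    ∃ g ∈ ismDH logv (.inr v), (p : ℝ) ^ C * ‖z‖ ≤ ‖toR p v hv (g (ofR p v hv s))‖ := by
  classical
  have hp1 : (1 : ℝ) < p := by exact_mod_cast hp.out.one_lt
  have hp0 : (0 : ℝ) < p := by positivity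
  have hpQ : ((p : ℕ) : ℚ_[p]) ≠ 0 := Nat.cast_ne_zero.2 hp.out.ne_zero
  -- (0) the levels of `s` are up-closed: `p^k s ∈ Λ ⟹ p^(k+1) s ∈ Λ` (`p·Λ ⊆ Λ`)
  have hup : ∀ k : ℤ, ((p : ℚ_[p]) ^ k) • s ∈ (logUnits (RescaledCompletion F p v hv) : Set (RescaledCompletion F p v hv)) →
      ((p : ℚ_[p]) ^ (k + 1)) • s ∈ (logUnits (RescaledCompletion F p v hv) : Set (RescaledCompletion F p v hv)) := by
    intro k hk
    have h := natCast_mul_mem_logUnits (p := p) (K := RescaledCompletion F p v hv) p hk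
    rw [zpow_add_one₀ hpQ, mul_comm, mul_smul,
      show ((p : ℚ_[p]) • (((p : ℚ_[p]) ^ k) • s) : RescaledCompletion F p v hv) =
        (p : RescaledCompletion F p v hv) * (((p : ℚ_[p]) ^ k) • s) by rw [Algebra.smul_def, map_natCast]]
    exact h
  -- (1) some level: `‖p^(C+n) s‖ ≤ p⁻²` for `n` large
  have hex : ∃ n : ℕ, ((p : ℚ_[p]) ^ (C + n)) • s ∈
      (logUnits (RescaledCompletion F p v hv) : Set (RescaledCompletion F p v hv)) := by
    obtain ⟨n, hn⟩ := pow_unbounded_of_one_lt (‖s‖ * (p : ℝ) ^ (2 - C)) hp1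
    refine ⟨n, closedBall_subset_logUnits p (RescaledCompletion F p v hv) ?_⟩
    rw [Set.mem_setOf_eq, norm_zpow_prime_smul,
      show ((p : ℝ) ^ (-(2 : ℝ))) = (p : ℝ) ^ (-(2 : ℤ)) by rw [← Real.rpow_intCast]; norm_num]
    have hsplit : (p : ℝ) ^ (-(C + (n : ℤ))) = (p : ℝ) ^ (-(2 : ℤ)) * ((p : ℝ) ^ (-(n : ℤ)) * (p : ℝ) ^ (2 - C)) := by
      rw [← zpow_add₀ hp0.ne', ← zpow_add₀ hp0.ne']
      congr 1; ring
    have h3 : (p : ℝ) ^ (-(n : ℤ)) * (p : ℝ) ^ (2 - C) * ‖s‖ ≤ 1 := by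
      rw [zpow_neg, zpow_natCast, mul_assoc, inv_mul_le_iff₀ (pow_pos hp0 n), mul_one, mul_comm]
      exact hn.le
    calc (p : ℝ) ^ (-(C + (n : ℤ))) * ‖s‖
        = (p : ℝ) ^ (-(2 : ℤ)) * ((p : ℝ) ^ (-(n : ℤ)) * (p : ℝ) ^ (2 - C) * ‖s‖) := by rw [hsplit]; ring
      _ ≤ (p : ℝ) ^ (-(2 : ℤ)) * 1 := by gcongr
      _ = (p : ℝ) ^ (-(2 : ℤ)) := mul_one _
  -- (2) the exact level `k = C + n₀ ≥ C`
  set n₀ := Nat.find hex with hn₀def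
  have hk_mem : ((p : ℚ_[p]) ^ (C + n₀)) • s ∈
      (logUnits (RescaledCompletion F p v hv) : Set (RescaledCompletion F p v hv)) := Nat.find_spec hex
  have hk_not : ((p : ℚ_[p]) ^ (C + n₀ - 1)) • s ∉
      (logUnits (RescaledCompletion F p v hv) : Set (RescaledCompletion F p v hv)) := by
    rcases Nat.eq_zero_or_pos n₀ with h0 | hpos
    · rw [h0, Nat.cast_zero, add_zero, hsu]; exact hu
    · obtain ⟨m, hm⟩ := Nat.exists_eq_succ_of_ne_zero hpos.ne'
      have hmin : ¬ ((p : ℚ_[p]) ^ (C + m)) • s ∈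
          (logUnits (RescaledCompletion F p v hv) : Set (RescaledCompletion F p v hv)) :=
        Nat.find_min hex (show m < n₀ by omega)
      rwa [hm, show C + ((m.succ : ℕ) : ℤ) - 1 = C + m by push_cast; ring]
  set k : ℤ := C + n₀ with hkdef
  have hkC : C ≤ k := by rw [hkdef]; exact le_add_of_nonneg_right (by positivity)
  -- (3) a largest-norm vector of `Λ` is primitive
  obtain ⟨z₀, hz₀, hmax⟩ := exists_norm_isMaxOn_logUnits p (RescaledCompletion F p v hv)
  have hz₀pos : 0 < ‖z₀‖ := norm_pos_of_isMaxOn_logUnits p (RescaledCompletion F p v hv) hmax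
  have hz₀prim : z₀ ∉ (p : ℚ_[p]) • (logUnits (RescaledCompletion F p v hv) : Set (RescaledCompletion F p v hv)) := by
    rintro ⟨w, hw, hwz⟩
    have h1 : ‖z₀‖ = (p : ℝ)⁻¹ * ‖w‖ := by
      rw [← show ((p : ℚ_[p]) • w : RescaledCompletion F p v hv) = z₀ from hwz, norm_smul, Padic.norm_p]
    have h2 : ‖w‖ ≤ ‖z₀‖ := hmax w hw
    have hw0 : 0 < ‖w‖ := by
      rcases (norm_nonneg w).eq_or_lt with h | h
      · rw [h1, ← h, mul_zero] at hz₀pos; exact absurd hz₀pos (lt_irrefl 0)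
      · exact h
    have h3 : (p : ℝ)⁻¹ * ‖w‖ < ‖w‖ := mul_lt_of_lt_one_left hw0 (inv_lt_one_of_one_lt₀ hp1)
    linarith
  -- (4) transitivity on the primitive vectors of `p^(-k) Λ`
  have hpk : ((p : ℚ_[p]) ^ (-k)) ≠ 0 := zpow_ne_zero _ hpQ
  have hx : s ∈ ((p : ℚ_[p]) ^ (-k)) • (logUnits (RescaledCompletion F p v hv) : Set (RescaledCompletion F p v hv)) :=
    ⟨((p : ℚ_[p]) ^ k) • s, hk_mem, by
      simp only [smul_smul, ← zpow_add₀ hpQ, neg_add_cancel, zpow_zero, one_smul]⟩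
  have hxp : s ∉ ((p : ℚ_[p]) * (p : ℚ_[p]) ^ (-k)) •
      (logUnits (RescaledCompletion F p v hv) : Set (RescaledCompletion F p v hv)) := by
    rintro ⟨w, hw, hws⟩
    apply hk_not
    have : ((p : ℚ_[p]) ^ (C + n₀ - 1)) • s = w := by
      rw [← hkdef, ← show (((p : ℚ_[p]) * (p : ℚ_[p]) ^ (-k)) • w : RescaledCompletion F p v hv) = s from hws, smul_smul,
        show (p : ℚ_[p]) ^ (k - 1) * ((p : ℚ_[p]) * (p : ℚ_[p]) ^ (-k)) = 1 by
          rw [← mul_assoc, ← zpow_add_one₀ hpQ, sub_add_cancel, ← zpow_add₀ hpQ, add_neg_cancel, zpow_zero],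
        one_smul]
    rw [this]; exact hw
  have hy : ((p : ℚ_[p]) ^ (-k)) • z₀ ∈
      ((p : ℚ_[p]) ^ (-k)) • (logUnits (RescaledCompletion F p v hv) : Set (RescaledCompletion F p v hv)) :=
    Set.smul_mem_smul_set hz₀
  have hyp : ((p : ℚ_[p]) ^ (-k)) • z₀ ∉ ((p : ℚ_[p]) * (p : ℚ_[p]) ^ (-k)) •
      (logUnits (RescaledCompletion F p v hv) : Set (RescaledCompletion F p v hv)) := by
    rintro ⟨w, hw, hww⟩
    apply hz₀prim
    refine ⟨w, hw, ?_⟩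
    have h1 : ((p : ℚ_[p]) ^ (-k)) • ((p : ℚ_[p]) • w) = ((p : ℚ_[p]) ^ (-k)) • z₀ := by
      rw [smul_smul, mul_comm]; exact hww
    exact smul_right_injective (RescaledCompletion F p v hv) hpk h1
  obtain ⟨g, hg, hgs⟩ := exists_mem_ismDH_apply_eq_of_primitive hlog v hv hx hxp hy hyp
  refine ⟨g, hg, ?_⟩
  -- (5) the reached norm
  rw [hgs, norm_zpow_prime_smul, neg_neg]
  exact mul_le_mul (zpow_le_zpow_right₀ hp1.le hkC) (hmax z hz) (norm_nonneg z) (zpow_nonneg hp0.le _)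

end OnePlace


/-! ## The fibre form (the presentation `φ_x` of the sharp settings is the identity on `K_x`) -/

section Fibre

variable {F : Type} [Field F] [NumberField F] (X : PilotData F) {logv : PadicLogs F} (hlog : LogvAnalytic logv)

/-- **The one-place mover at a fibre point** (`kOf X p x` IS the rescaled completion at `placeOf x`; the presentation's `φ_x` is the
identity): `p^{C−1}·s = u ∉ log_p(𝒪_x^×)` ⟹ some `g ∈ Ism_x` has `p^C·‖z‖ ≤ ‖g s‖` for every log-unit `z`.
[cite: WeilBNT1967, Ch. II §2, Th. 1] [cite: DupuyHilado2025, §4.9] -/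
theorem exists_mover_of_not_mem_logUnits_fibre (pp : Nat.Primes) (x : (thetaIndex X).Fibre (.inr pp))
    {C : ℤ} {s u z : haveI : Fact (pp : ℕ).Prime := ⟨pp.2⟩; kOf X pp.1 x}
    (hsu : haveI : Fact (pp : ℕ).Prime := ⟨pp.2⟩; ((pp : ℚ_[pp]) ^ (C - 1)) • s = u)
    (hu : haveI : Fact (pp : ℕ).Prime := ⟨pp.2⟩; u ∉ (logUnits (kOf X pp.1 x) : Set (kOf X pp.1 x)))
    (hz : haveI : Fact (pp : ℕ).Prime := ⟨pp.2⟩; z ∈ (logUnits (kOf X pp.1 x) : Set (kOf X pp.1 x))) :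
    haveI : Fact (pp : ℕ).Prime := ⟨pp.2⟩
    ∃ g ∈ (logShellsDH X logv).ism x.1,
      (pp : ℝ) ^ C * ‖z‖ ≤ ‖(presAt X hlog pp).φ x (g (((presAt X hlog pp).φ x).symm s))‖ := by
  haveI : Fact (pp : ℕ).Prime := ⟨pp.2⟩
  obtain ⟨x1, hx⟩ := x
  rcases x1 with w | v
  · exact absurd hx (by simp [thetaIndex])
  · obtain ⟨g, hg, hgn⟩ :=
      exists_mover_of_not_mem_logUnits (hlog pp) v (natCast_mem_placeOf X pp.1 ⟨.inr v, hx⟩) hsu hu hz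
    exact ⟨g, hg, hgn⟩

end Fibre

end Summit.ABC.IUTFork.Repair.RHLevelMover

end
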